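import Summits.BirchSwinnertonDyer.BirchSwinnertonDyer.Theorems.ByReductionTypeAtTwoRankOneAtTwoBigImageOddLocalFklLevelShift
import HarnessLib

/-!
# Line `fkl` of crux `RankOneAtTwoBigImageOddLocal` (stmt-BirchSwinnertonDyer-23715, route ByReductionTypeAtTwo):
# K2-F as «THE FIRST NON-VANISHING LEVEL IS `s + 2`» — clause (a) is void above level `s + 1`, clause (b) lives at level `s + 2`

Lead prover seat `bsd-line-fkl-p1` (g2), helpers `--supports stmt-BirchSwinnertonDyer-23715` (v7 stubs (2a) `stub_firstLayerHigherCongruence`,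
(2b) `stub_firstLayerNonVanishing` and their analytic twins); sequel to `…FklLevelShift` (p598376).

Iterating the LEVEL SHIFT (`inTwoPowZLoc_levelSumTwo_succ_iff`: at every `τ`-row `δ'_{j+1}(ψ) ∈ 2^m ℤ_{(2)} ⟺ δ'_j(ψ mod 2^j) ∈ 2^m ℤ_{(2)}`,
`m ≤ j+1`) down a chain of reductions gives, for the newform `f` of a globally minimal curve of POSITIVE analytic rank and an odd prime
`ℓ ∤ N_W` (`inTwoPowZLoc_levelSumTwo_iff_reduction`):  for `k' ≤ k`, `ψ` onto `ℤ/2^k` with `2^k ∣ ℓ − 1`, `ψ' = ψ mod 2^{k'}` and `m ≤ k'+1`,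
`δ'_k(ℓ; ψ) ∈ 2^m ℤ_{(2)} ⟺ δ'_{k'}(ℓ; ψ') ∈ 2^m ℤ_{(2)}`.
CONSEQUENCES for the v7 stubs (per curve, parameter `s` free — so for K2-F with `s = ord₂ #Ш[2^∞]` and for K2-F_an with `s_an`):
* `clauseA_iff_ownLevel_upto` — clause (a) «every row `(ℓ,k,ψ)` has `δ'_k ∈ 2^{min(k,s+1)} ℤ_{(2)}`» ⟺ «every row with `k ≤ s + 1` has
  `δ'_k ≡ 0 (mod 2^k)`»: the rows ABOVE level `s+1` carry nothing (they reduce to the level-`(s+1)` row), i.e. (HC) = «levels `2, …, s+1`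
  vanish identically at their own level» (level `1` does by g0's theorem);
* `clauseB_iff_level` — clause (b) «some row with `k ≥ s+2` has `δ'_k ∉ 2^{s+2} ℤ_{(2)}`» ⟺ «some row AT level `k = s+2` has
  `δ'_{s+2} ≢ 0 (mod 2^{s+2})`»: (NV) = «level `s+2` does NOT vanish identically at its own level».
So K2-F reads: **the first level of the first Kolyvagin layer that does not vanish identically at its own level is exactly `s + 2`**
(Kurihara/Kim's «order of vanishing» formulation at `p = 2`, with the one-bit shift `δ' = 2δ`).  Theorems only; no `def`, no named-fact
hypothesis, no `sorry`.  BSD is not proved by any of this.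
-/

set_option autoImplicit false

noncomputable section

open scoped Classical MatrixGroups ModularForm

set_option linter.dupNamespace false

namespace Summit.BirchSwinnertonDyer.BirchSwinnertonDyer.Theorems.RankOneAtTwoFkl

open CongruenceSubgroup WeierstrassCurve Literature.NumberTheory.EllipticCurves
  Literature.NumberTheory.EllipticCurves.ModularForms Summit.BirchSwinnertonDyer.Rank1Residual.F1Sign2

/-! ## Iterated level shift -/

/-- **Iterated level shift.**  For the newform `f` of a globally minimal `W/ℚ` of positive analytic rank, an odd prime `ℓ ∤ N_W`,
levels `k' + d = k`, a surjective `ψ : (ℤ/ℓ)ˣ → ℤ/2^k` with `2^k ∣ ℓ − 1`, its reduction `ψ' = ψ mod 2^{k'}` and any `m ≤ k' + 1`: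
`δ'_k(ℓ; ψ) ∈ 2^m ℤ_{(2)} ⟺ δ'_{k'}(ℓ; ψ') ∈ 2^m ℤ_{(2)}`. [folklore] -/
theorem inTwoPowZLoc_levelSumTwo_iff_reduction (W : WeierstrassCurve ℚ) [W.IsElliptic] [W.IsGloballyMinimal]
    {M : ℕ} [NeZero M] (f : CuspForm (Gamma0 M) 2) (hf : IsNewformOf W f) (hr : W.analyticRank ≠ 0)
    {ℓ : ℕ} [Fact ℓ.Prime] (hℓ2 : ℓ ≠ 2) (hN : ¬ ℓ ∣ W.conductorNorm ℤ) (d : ℕ) :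
    ∀ (k' : ℕ) (ψ : (ZMod ℓ)ˣ →* Multiplicative (ZMod (2 ^ (k' + d)))), Function.Surjective ψ →
      2 ^ (k' + d) ∣ ℓ - 1 →
      ∀ (ψ' : (ZMod ℓ)ˣ →* Multiplicative (ZMod (2 ^ k'))),
        (∀ u, (Multiplicative.toAdd (ψ' u)).val = (Multiplicative.toAdd (ψ u)).val % 2 ^ k') →
        ∀ {m : ℕ}, m ≤ k' + 1 →
          (InTwoPowZLoc m (levelSumTwo f ℓ (k' + d) ψ) ↔ InTwoPowZLoc m (levelSumTwo f ℓ k' ψ')) := by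
  induction d with
  | zero =>
    intro k' ψ _hψ _h1 ψ' hψ' m _hm
    haveI : NeZero (2 ^ k') := ⟨by positivity⟩
    have heq : levelSumTwo f ℓ (k' + 0) ψ = levelSumTwo f ℓ k' ψ' := by
      unfold levelSumTwo
      refine Finset.sum_congr rfl fun u _ => ?_
      have hv : (Multiplicative.toAdd (ψ' u)).val = (Multiplicative.toAdd (ψ u)).val := by
        rw [hψ' u]
        exact Nat.mod_eq_of_lt (ZMod.val_lt _)
      rw [hv]
    rw [heq]
  | succ d ih =>
    intro k' ψ hψ h1 ψ' hψ' m hm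
    obtain ⟨ψ₁, hψ₁s, hψ₁⟩ := exists_levelChar_reduction (j := k' + d) ψ hψ
    have step : InTwoPowZLoc m (levelSumTwo f ℓ (k' + d + 1) ψ) ↔ InTwoPowZLoc m (levelSumTwo f ℓ (k' + d) ψ₁) :=
      inTwoPowZLoc_levelSumTwo_succ_iff W f hf hr hℓ2 hN (j := k' + d) h1 ψ hψ ψ₁ hψ₁ (by omega)
    have h1' : 2 ^ (k' + d) ∣ ℓ - 1 := dvd_trans (pow_dvd_pow 2 (by omega)) h1
    have hcompat : ∀ u, (Multiplicative.toAdd (ψ' u)).val = (Multiplicative.toAdd (ψ₁ u)).val % 2 ^ k' := by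
      intro u
      rw [hψ' u, hψ₁ u, Nat.mod_mod_of_dvd _ (pow_dvd_pow 2 (by omega))]
    have ih' := ih k' ψ₁ hψ₁s h1' ψ' hcompat hm
    show InTwoPowZLoc m (levelSumTwo f ℓ (k' + d + 1) ψ) ↔ _
    rw [step, ih']

/-- **Reduction to a lower level exists** (iterate `exists_levelChar_reduction`): a surjective `ψ : G → ℤ/2^{k'+d}` reduces to a surjective
`ψ' : G → ℤ/2^{k'}` with `ψ̃' = ψ̃ mod 2^{k'}`. [folklore] -/
theorem exists_levelChar_reduction_le {G : Type*} [Group G] (d : ℕ) :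
    ∀ (k' : ℕ) (ψ : G →* Multiplicative (ZMod (2 ^ (k' + d)))), Function.Surjective ψ →
      ∃ ψ' : G →* Multiplicative (ZMod (2 ^ k')), Function.Surjective ψ' ∧
        ∀ u, (Multiplicative.toAdd (ψ' u)).val = (Multiplicative.toAdd (ψ u)).val % 2 ^ k' := by
  induction d with
  | zero =>
    intro k' ψ hψ
    haveI : NeZero (2 ^ k') := ⟨by positivity⟩
    exact ⟨ψ, hψ, fun u => (Nat.mod_eq_of_lt (ZMod.val_lt _)).symm⟩
  | succ d ih =>
    intro k' ψ hψ
    obtain ⟨ψ₁, hψ₁s, hψ₁⟩ := exists_levelChar_reduction (j := k' + d) ψ hψ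
    obtain ⟨ψ', hψ's, hψ'⟩ := ih k' ψ₁ hψ₁s
    refine ⟨ψ', hψ's, fun u => ?_⟩
    rw [hψ' u, hψ₁ u, Nat.mod_mod_of_dvd _ (pow_dvd_pow 2 (by omega))]

/-! ## Clause (a): nothing above level `s + 1` -/

/-- **Clause (a) of K2-F / K2-F_an ⟺ «levels `≤ s+1` vanish at their own level»** (per curve and newform, parameter `s` free; positive
analytic rank).  The rows `(ℓ, k, ψ)` with `k ≥ s + 2` reduce to the row `(ℓ, s+1, ψ mod 2^{s+1})` by the iterated level shift.
[conjecture] reading, kernel theorem. -/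
theorem clauseA_iff_ownLevel_upto (W : WeierstrassCurve ℚ) [W.IsElliptic] [W.IsGloballyMinimal]
    {M : ℕ} [NeZero M] (f : CuspForm (Gamma0 M) 2) (hf : IsNewformOf W f) (hr : W.analyticRank ≠ 0) (s : ℕ) :
    (∀ (ℓ k : ℕ) [Fact ℓ.Prime], IsLevelAtTwo W ℓ → 1 ≤ k → (2 ^ k : ℤ) ∣ (ℓ : ℤ) - 1 →
        (2 ^ k : ℤ) ∣ W.frobeniusTrace ℓ - 2 →
        ∀ ψ : (ZMod ℓ)ˣ →* Multiplicative (ZMod (2 ^ k)), Function.Surjective ψ →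
          InTwoPowZLoc (min k (s + 1)) (levelSumTwo f ℓ k ψ)) ↔
    (∀ (ℓ k : ℕ) [Fact ℓ.Prime], IsLevelAtTwo W ℓ → 1 ≤ k → k ≤ s + 1 → (2 ^ k : ℤ) ∣ (ℓ : ℤ) - 1 →
        (2 ^ k : ℤ) ∣ W.frobeniusTrace ℓ - 2 →
        ∀ ψ : (ZMod ℓ)ˣ →* Multiplicative (ZMod (2 ^ k)), Function.Surjective ψ →
          InTwoPowZLoc k (levelSumTwo f ℓ k ψ)) := by
  constructor
  · intro h ℓ k _ hlev hk hks hℓk ha ψ hψ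
    have := h ℓ k hlev hk hℓk ha ψ hψ
    rwa [show min k (s + 1) = k by omega] at this
  · intro h ℓ k _ hlev hk hℓk ha ψ hψ
    by_cases hks : k ≤ s + 1
    · rw [show min k (s + 1) = k by omega]
      exact h ℓ k hlev hk hks hℓk ha ψ hψ
    · -- reduce the row to level `s + 1`
      have hℓ : ℓ.Prime := Fact.out
      obtain ⟨hℓ2, hN⟩ := ne_two_and_not_dvd_of_isLevelAtTwo W hlev
      obtain ⟨d, rfl⟩ : ∃ d, k = (s + 1) + d := ⟨k - (s + 1), by omega⟩
      obtain ⟨ψ', hψ's, hψ'⟩ := exists_levelChar_reduction_le d (s + 1) ψ hψ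
      have h1nat : 2 ^ (s + 1 + d) ∣ ℓ - 1 := by
        have h1 : 1 ≤ ℓ := hℓ.one_lt.le
        have : ((2 ^ (s + 1 + d) : ℕ) : ℤ) ∣ ((ℓ - 1 : ℕ) : ℤ) := by push_cast [Nat.cast_sub h1]; exact hℓk
        exact Int.natCast_dvd_natCast.mp this
      have hrow : InTwoPowZLoc (s + 1) (levelSumTwo f ℓ (s + 1) ψ') :=
        h ℓ (s + 1) hlev (by omega) le_rfl (dvd_trans (pow_dvd_pow 2 (by omega)) hℓk)
          (dvd_trans (pow_dvd_pow 2 (by omega)) ha) ψ' hψ's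
      rw [show min (s + 1 + d) (s + 1) = s + 1 by omega]
      exact (inTwoPowZLoc_levelSumTwo_iff_reduction W f hf hr hℓ2 hN d (s + 1) ψ hψ h1nat ψ' hψ' (m := s + 1) (by omega)).mpr hrow

/-! ## Clause (b): lives at level `s + 2` -/

/-- **Clause (b) of K2-F / K2-F_an ⟺ «level `s+2` does not vanish at its own level somewhere»** (per curve and newform, parameter `s`
free; positive analytic rank): a witness row `(ℓ, k, ψ)` with `k ≥ s+2` reduces to the witness row `(ℓ, s+2, ψ mod 2^{s+2})`.
[conjecture] reading, kernel theorem. -/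
theorem clauseB_iff_level (W : WeierstrassCurve ℚ) [W.IsElliptic] [W.IsGloballyMinimal]
    {M : ℕ} [NeZero M] (f : CuspForm (Gamma0 M) 2) (hf : IsNewformOf W f) (hr : W.analyticRank ≠ 0) (s : ℕ) :
    (∃ (ℓ k : ℕ) (_ : Fact ℓ.Prime) (ψ : (ZMod ℓ)ˣ →* Multiplicative (ZMod (2 ^ k))),
        IsLevelAtTwo W ℓ ∧ s + 2 ≤ k ∧ (2 ^ k : ℤ) ∣ (ℓ : ℤ) - 1 ∧ (2 ^ k : ℤ) ∣ W.frobeniusTrace ℓ - 2 ∧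
        Function.Surjective ψ ∧ ¬ InTwoPowZLoc (s + 2) (levelSumTwo f ℓ k ψ)) ↔
    (∃ (ℓ : ℕ) (_ : Fact ℓ.Prime) (ψ : (ZMod ℓ)ˣ →* Multiplicative (ZMod (2 ^ (s + 2)))),
        IsLevelAtTwo W ℓ ∧ (2 ^ (s + 2) : ℤ) ∣ (ℓ : ℤ) - 1 ∧ (2 ^ (s + 2) : ℤ) ∣ W.frobeniusTrace ℓ - 2 ∧
        Function.Surjective ψ ∧ ¬ InTwoPowZLoc (s + 2) (levelSumTwo f ℓ (s + 2) ψ)) := by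
  constructor
  · rintro ⟨ℓ, k, hℓF, ψ, hlev, hk, hℓk, ha, hψ, hnot⟩
    have hℓ : ℓ.Prime := Fact.out
    obtain ⟨hℓ2, hN⟩ := ne_two_and_not_dvd_of_isLevelAtTwo W hlev
    obtain ⟨d, rfl⟩ : ∃ d, k = (s + 2) + d := ⟨k - (s + 2), by omega⟩
    obtain ⟨ψ', hψ's, hψ'⟩ := exists_levelChar_reduction_le d (s + 2) ψ hψ
    have h1nat : 2 ^ (s + 2 + d) ∣ ℓ - 1 := by
      have h1 : 1 ≤ ℓ := hℓ.one_lt.le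
      have : ((2 ^ (s + 2 + d) : ℕ) : ℤ) ∣ ((ℓ - 1 : ℕ) : ℤ) := by push_cast [Nat.cast_sub h1]; exact hℓk
      exact Int.natCast_dvd_natCast.mp this
    refine ⟨ℓ, hℓF, ψ', hlev, dvd_trans (pow_dvd_pow 2 (by omega)) hℓk, dvd_trans (pow_dvd_pow 2 (by omega)) ha, hψ's, ?_⟩
    intro hrow
    exact hnot ((inTwoPowZLoc_levelSumTwo_iff_reduction W f hf hr hℓ2 hN d (s + 2) ψ hψ h1nat ψ' hψ' (m := s + 2) (by omega)).mpr hrow)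
  · rintro ⟨ℓ, hℓF, ψ, hlev, hℓk, ha, hψ, hnot⟩
    exact ⟨ℓ, s + 2, hℓF, ψ, hlev, le_rfl, hℓk, ha, hψ, hnot⟩

end Summit.BirchSwinnertonDyer.BirchSwinnertonDyer.Theorems.RankOneAtTwoFkl

end
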